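import Mathlib.Analysis.Calculus.BumpFunction.Convolution
import Mathlib.Analysis.Calculus.BumpFunction.FiniteDimension
import Mathlib.Analysis.Calculus.ContDiff.Convolution
import Mathlib.MeasureTheory.Measure.Haar.OfBasis
import Literature.Geometry.Riemannian.RiemannianDistance
import Literature.Geometry.Lorentzian.VolumeChartFormula
import Literature.Geometry.Lorentzian.ChartLaplacian
import Literature.Geometry.Lorentzian.GreenIdentity
import Literature.Geometry.Lorentzian.EnergyCurrents
import HarnessLib

/-!
# Smooth approximation of Lipschitz functions with gradient control on closed Riemannian
# manifolds (Azagra–Ferrera–López-Mesas–Rangel 2007, Thm. 1, compact case)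

For a smooth Riemannian metric `g` (a Riemannian `PseudoRiemannianMetric` on `TM`, model space
`E` any finite-dimensional real normed space, boundaryless model) on a compact manifold `M`, its
Riemannian distance `d_g = g.edist hg` (`RiemannianDistance.lean`, Mathlib's `riemannianEDist`)
and a continuous `F : M → ℝ` with `|F x - F y| ≤ L d_g(x, y)` (stated in `ℝ≥0∞`, so that points
at infinite distance impose nothing), we PROVE

* `exists_contMDiff_abs_sub_lt_gradSq_le` — for every `ε > 0` there is a `C^∞` function
  `χ : M → ℝ` with `|χ x - F x| < ε` and `|∇χ|²_g (x) = g⁻¹(dχ, dχ)(x) ≤ (L + ε)²` for all `x`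
  (Azagra–Ferrera–López-Mesas–Rangel, J. Math. Anal. Appl. 326 (2007), Thm. 1: "there exists a
  `C^∞` smooth Lipschitz function `g` such that `|f(p) - g(p)| ≤ ε(p)` … and
  `Lip(g) ≤ Lip(f) + r`"; here the compact case, with the conclusion in the infinitesimal form
  `|dχ_x| ≤ L + ε` needed for test functions, e.g. the cutoffs `ψ(d(x,p)/r)` of Perelman's no
  local collapsing theorem, Topping 2006, proof of Lemma 8.3.5).

The proof is the classical one (loc. cit., proof of Thm. 1 in the finite-dimensional case;
Greene–Wu): convolution in charts glued by a partition of unity, with the observation that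
mollification does not increase Lipschitz constants measured in the pulled-back metric.

* Mollification on `E` (`Mathlib.Analysis.Convolution`, normalised bumps `ContDiffBump.normed`
  and an additive Haar measure): increments and directional derivatives of `ψ ⋆ G` are bounded
  by increments of `G` (`abs_normed_convolution_add_sub_le`,
  `abs_fderiv_normed_convolution_apply_le`).
* Chart geometry: the length of the pull-back of a chart segment `[a, a + tw]` is at most
  `t · sup |D(φ⁻¹) w|_g` (`edist_symm_le_of_forall_val_le`, via `riemannianEDist_le_pathELength`);
  the pulled-back metric `(a, w) ↦ |D(φ⁻¹)_a w|²_g` is continuous on `φ.target × E`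
  (`continuousOn_val_mfderivWithin_symm`, from the smooth chart Gram matrix of
  `ChartLaplacian.lean`) and hence locally almost constant, uniformly on compact sets
  (`exists_forall_val_mfderivWithin_symm_le`).
* The local estimate `|D(ψ_R ⋆ (F ∘ φ⁻¹))(y) w| ≤ L · sup_{B(y,2R)} |D(φ⁻¹) w|_g`
  (`abs_fderiv_mollify_le`) and its manifold form (`abs_mvfderiv_comp_extChartAt_le`,
  `exists_contDiff_chart_smoothing`: `|d(Φ ∘ φ)_x u| ≤ L (1 + η) |u|_g`, `|Φ ∘ φ - F| ≤ η'` on a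
  compact subset of the chart domain).
* Gluing: a finite atlas, Mathlib's `SmoothPartitionOfUnity.exists_isSubordinate`, and
  `χ = ∑ᵢ ρᵢ · (Φᵢ ∘ φᵢ)`, `dχ = ∑ᵢ (Φᵢ ∘ φᵢ - F) dρᵢ + ∑ᵢ ρᵢ d(Φᵢ ∘ φᵢ)` (as `∑ᵢ dρᵢ = 0`);
  pointwise Cauchy–Schwarz `|dρ(v)| ≤ |∇ρ|_g |v|_g` and the converse
  `(∀ v, |dχ(v)| ≤ A |v|_g) ⇒ |∇χ|² ≤ A²` (`abs_mvfderiv_le_sqrt_gradSq_mul_sqrt`,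
  `gradSq_le_sq_of_forall_abs_mvfderiv_le`).

Everything is proved; there are no definitions and no named facts.

## References

* D. Azagra, J. Ferrera, F. López-Mesas, Y. Rangel, *Smooth approximation of Lipschitz functions
  on Riemannian manifolds*, J. Math. Anal. Appl. 326 (2007), 1370–1378, Thm. 1 (arXiv:math/0602051).
  [AzagraEtAl2007]
* P. Topping, *Lectures on the Ricci flow*, LMS Lecture Note Series 325, CUP 2006, §8.3, proof of
  Lemma 8.3.5 (the cutoff `φ = ψ(d(x,p)/r)`, "by approximation"). [Topping2006]
-/

noncomputable section

open Bundle Set Function Filter Manifold MeasureTheory Metric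
open scoped Manifold ContDiff Topology ENNReal NNReal Convolution

namespace Literature.Geometry.Riemannian

open Lorentzian

/-! ### Mollification on a finite-dimensional space: increments and directional derivatives -/

section Mollify

variable {E : Type*} [NormedAddCommGroup E] [NormedSpace ℝ E] [FiniteDimensional ℝ E]
  [MeasurableSpace E] [BorelSpace E] {μ : Measure E} [μ.IsAddHaarMeasure]

/-- **Increments of a mollification are averages of increments.** For a normalised bump `φ`
(support in `B(0, R)`, `R = φ.rOut`), a locally integrable `G` and `y, h`: if
`|G(a + h) - G(a)| ≤ B` for all `a ∈ B(y, R)`, then `|(φ ⋆ G)(y + h) - (φ ⋆ G)(y)| ≤ B`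
(`(φ ⋆ G)(y + h) - (φ ⋆ G)(y) = ∫ φ(t) [G(y + h - t) - G(y - t)] dt`). [folklore] -/
theorem abs_normed_convolution_add_sub_le (φ : ContDiffBump (0 : E)) {G : E → ℝ}
    (hG : LocallyIntegrable G μ) {y h : E} {B : ℝ}
    (hB : ∀ a ∈ ball y φ.rOut, |G (a + h) - G a| ≤ B) :
    |(φ.normed μ ⋆[ContinuousLinearMap.lsmul ℝ ℝ, μ] G) (y + h) -
      (φ.normed μ ⋆[ContinuousLinearMap.lsmul ℝ ℝ, μ] G) y| ≤ B := by
  have hex : ∀ x, ConvolutionExistsAt (φ.normed μ) G x (ContinuousLinearMap.lsmul ℝ ℝ) μ :=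
    fun x ↦ φ.hasCompactSupport_normed.convolutionExists_left _ φ.continuous_normed hG x
  have i1 : Integrable (fun t ↦ φ.normed μ t • G (y + h - t)) μ := hex (y + h)
  have i2 : Integrable (fun t ↦ φ.normed μ t • G (y - t)) μ := hex y
  simp only [convolution_lsmul]
  rw [← integral_sub i1 i2]
  have hbound : ∀ t, ‖φ.normed μ t • G (y + h - t) - φ.normed μ t • G (y - t)‖ ≤
      B * φ.normed μ t := by
    intro t
    rw [← smul_sub, norm_smul, Real.norm_of_nonneg (φ.nonneg_normed t), mul_comm]
    by_cases ht : φ.normed μ t = 0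
    · simp [ht]
    · have ht' : t ∈ ball (0 : E) φ.rOut := by
        rw [← φ.support_normed_eq (μ := μ)]; exact ht
      have ha : y - t ∈ ball y φ.rOut := by
        rw [mem_ball_iff_norm, sub_sub_cancel_left, norm_neg]
        simpa using ht'
      have := hB (y - t) ha
      rw [show y - t + h = y + h - t by abel] at this
      rw [Real.norm_eq_abs]
      exact mul_le_mul_of_nonneg_right this (φ.nonneg_normed t)
  have hint : Integrable (fun t ↦ B * φ.normed μ t) μ := φ.integrable_normed.const_mul B
  have h1 := norm_integral_le_of_norm_le hint (Eventually.of_forall hbound)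
  rw [integral_const_mul, φ.integral_normed, mul_one, Real.norm_eq_abs] at h1
  exact h1

/-- **Directional derivatives of a mollification.** For a normalised bump `φ` (`R = φ.rOut`),
a locally integrable `G`, a point `y`, a direction `w` and `B ≥ 0`: if for all real `t` with
`|t| < δ` and all `a ∈ B(y, R)` one has `|G(a + t w) - G(a)| ≤ B |t|`, then the derivative of the
(smooth) mollification satisfies `|D(φ ⋆ G)(y) w| ≤ B`. [folklore] -/
theorem abs_fderiv_normed_convolution_apply_le (φ : ContDiffBump (0 : E)) {G : E → ℝ}
    (hG : LocallyIntegrable G μ) {y w : E} {B δ : ℝ} (hB0 : 0 ≤ B) (hδ : 0 < δ)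
    (hB : ∀ t : ℝ, |t| < δ → ∀ a ∈ ball y φ.rOut, |G (a + t • w) - G a| ≤ B * |t|) :
    |fderiv ℝ (φ.normed μ ⋆[ContinuousLinearMap.lsmul ℝ ℝ, μ] G) y w| ≤ B := by
  set Φ : E → ℝ := φ.normed μ ⋆[ContinuousLinearMap.lsmul ℝ ℝ, μ] G with hΦ
  have hΦs : ContDiff ℝ 1 Φ :=
    φ.hasCompactSupport_normed.contDiff_convolution_left _ φ.contDiff_normed hG
  have hΦd : DifferentiableAt ℝ Φ y := (hΦs.differentiable one_ne_zero) y
  -- the curve `t ↦ Φ (y + t w)` has derivative `DΦ(y) w` at `0`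
  have hline : HasDerivAt (fun t : ℝ ↦ Φ (y + t • w)) (fderiv ℝ Φ y w) 0 := by
    have h1 : HasDerivAt (fun t : ℝ ↦ y + t • w) w 0 := by
      simpa using ((hasDerivAt_id (0 : ℝ)).smul_const w).const_add y
    have h2 : HasFDerivAt Φ (fderiv ℝ Φ y) (y + (0 : ℝ) • w) := by
      simpa using hΦd.hasFDerivAt
    exact h2.comp_hasDerivAt 0 h1
  -- and Lipschitz-type increments at `0`
  have hlip : ∀ᶠ t in 𝓝 (0 : ℝ), ‖Φ (y + t • w) - Φ (y + (0 : ℝ) • w)‖ ≤ B * ‖t - 0‖ := by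
    filter_upwards [Metric.ball_mem_nhds (0 : ℝ) hδ] with t ht
    rw [zero_smul, add_zero, sub_zero, Real.norm_eq_abs, Real.norm_eq_abs]
    have ht' : |t| < δ := by simpa [Real.dist_eq] using ht
    exact abs_normed_convolution_add_sub_le φ hG (fun a ha ↦ hB t ht' a ha)
  have := hline.hasFDerivAt.le_of_lip' hB0 hlip
  rwa [ContinuousLinearMap.norm_toSpanSingleton, Real.norm_eq_abs] at this

end Mollify

/-! ### Chart geometry: the pulled-back metric `a ↦ |D(φ⁻¹)_a w|²_g` -/

section Chart

variable {E : Type*} [NormedAddCommGroup E] [NormedSpace ℝ E] [FiniteDimensional ℝ E]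
  {H : Type*} [TopologicalSpace H] {I : ModelWithCorners ℝ E H} [I.Boundaryless]
  {M : Type*} [TopologicalSpace M] [ChartedSpace H M] [IsManifold I ∞ M]
  (g : PseudoRiemannianMetric I ∞ E (TangentSpace I : M → Type _))

omit [I.Boundaryless] in
set_option backward.isDefEq.respectTransparency false in
/-- **Length of a chart segment in a direction.** Let `φ = extChartAt I x₀`, `a, w ∈ E`,
`t ≥ 0`, with the segment `[a, a + t w]` inside `φ.target`, and suppose
`g(D(φ⁻¹)_{a+uw} w, D(φ⁻¹)_{a+uw} w) ≤ B²` for `u ∈ [0, t]` (`B ≥ 0`). Then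
`d_g(φ⁻¹ a, φ⁻¹ (a + t w)) ≤ t B`: the segment pulls back to a `C¹` path of speed `≤ B`
(cf. `riemannianEDist_symm_le_of_forall_norm_mfderivWithin_le`, the operator-norm version).
[folklore] -/
theorem edist_symm_le_of_forall_val_le (hg : g.IsRiemannian) (x₀ : M) {a w : E} {t B : ℝ}
    (ht : 0 ≤ t) (hB : 0 ≤ B)
    (hseg : segment ℝ a (a + t • w) ⊆ (extChartAt I x₀).target)
    (hD : ∀ u ∈ Icc (0 : ℝ) t, g.val ((extChartAt I x₀).symm (a + u • w))
        (mfderivWithin 𝓘(ℝ, E) I (extChartAt I x₀).symm (range I) (a + u • w) w)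
        (mfderivWithin 𝓘(ℝ, E) I (extChartAt I x₀).symm (range I) (a + u • w) w) ≤ B ^ 2) :
    g.edist hg ((extChartAt I x₀).symm a) ((extChartAt I x₀).symm (a + t • w)) ≤
      ENNReal.ofReal (t * B) := by
  letI := g.riemannianBundle hg
  letI _i₁ : (p : E) → NormedAddCommGroup (TangentSpace 𝓘(ℝ, E) p) := fun p ↦
    normedAddCommGroupTangentSpaceVectorSpace p
  letI _i₂ : (p : E) → NormedSpace ℝ (TangentSpace 𝓘(ℝ, E) p) := fun p ↦
    normedSpaceTangentSpaceVectorSpace p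
  -- the segment `η` and its pull-back `γ`
  let η := ContinuousAffineMap.lineMap (R := ℝ) a (a + t • w)
  set γ := (extChartAt I x₀).symm ∘ η with hγdef
  have hηapp : ∀ s : ℝ, η s = a + (s * t) • w := by
    intro s
    simp only [η, ContinuousAffineMap.coe_lineMap_eq, AffineMap.lineMap_apply_module]
    module
  have hη : Icc (0 : ℝ) 1 ⊆ ⇑η ⁻¹' (extChartAt I x₀).target := by
    intro s hs
    have : η s ∈ segment ℝ a (a + t • w) := by
      rw [segment_eq_image_lineMap]
      exact ⟨s, hs, by simp [η, ContinuousAffineMap.coe_lineMap_eq]⟩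
    exact hseg this
  have η_smooth : CMDiff[Icc 0 1] 1 η := by
    apply ContMDiff.contMDiffOn
    rw [contMDiff_iff_contDiff]
    exact ContinuousAffineMap.contDiff _
  -- the Riemannian distance is bounded by the length of `γ`
  have hγ : g.edist hg ((extChartAt I x₀).symm a) ((extChartAt I x₀).symm (a + t • w))
      ≤ pathELength I γ 0 1 := by
    apply riemannianEDist_le_pathELength _ _ _ zero_le_one
    · exact (contMDiffOn_extChartAt_symm x₀).comp η_smooth (fun s hs ↦ hη hs)
    · simp [γ, η, ContinuousAffineMap.coe_lineMap_eq]
    · simp [γ, η, ContinuousAffineMap.coe_lineMap_eq]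
  apply hγ.trans
  rw [pathELength_eq_lintegral_mfderivWithin_Icc]
  -- the speed of `γ` is `|D(φ⁻¹)(η s) (t w)|_g ≤ t B`
  have hspeed : ∀ s ∈ Icc (0 : ℝ) 1, ‖mfderiv[Icc 0 1] γ s 1‖ₑ ≤ ENNReal.ofReal (t * B) := by
    intro s hs
    have h₁ : mfderiv[Icc 0 1] γ s =
        (mfderiv[range I] (extChartAt I x₀).symm (η s)) ∘L (mfderiv[Icc 0 1] η s) := by
      apply mfderivWithin_comp
      · exact mdifferentiableWithinAt_extChartAt_symm (hη hs)
      · exact η_smooth.mdifferentiableOn one_ne_zero s hs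
      · exact fun s hs ↦ extChartAt_target_subset_range x₀ (hη hs)
      · rw [uniqueMDiffWithinAt_iff_uniqueDiffWithinAt]
        exact uniqueDiffOn_Icc zero_lt_one s hs
    have h₂ : mfderiv[Icc 0 1] γ s 1 =
        (mfderiv[range I] (extChartAt I x₀).symm (η s)) (mfderiv[Icc 0 1] η s 1) := congr($h₁ 1)
    have h₃ : mfderiv[Icc 0 1] η s 1 = (a + t • w) - a := by
      rw [mfderivWithin_eq_fderivWithin]
      exact fderivWithin_lineMap_Icc_apply_one a (a + t • w) hs
    rw [h₂, h₃, add_sub_cancel_left, ContinuousLinearMap.map_smul]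
    have hst : s * t ∈ Icc 0 t := ⟨mul_nonneg hs.1 ht, by nlinarith [hs.2]⟩
    have hval := hD (s * t) hst
    rw [← hηapp s] at hval
    -- `‖v‖ = √(g(v,v))`
    have hnorm : ‖(mfderiv[range I] (extChartAt I x₀).symm (η s)) w‖ ≤ B := by
      rw [g.norm_eq_sqrt hg]
      calc Real.sqrt _ ≤ Real.sqrt (B ^ 2) := Real.sqrt_le_sqrt hval
        _ = B := Real.sqrt_sq hB
    rw [enorm_smul, ← ofReal_norm, ← ofReal_norm, Real.norm_of_nonneg ht,
      ← ENNReal.ofReal_mul ht]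
    exact ENNReal.ofReal_le_ofReal (mul_le_mul_of_nonneg_left hnorm ht)
  calc ∫⁻ s in Icc (0 : ℝ) 1, ‖mfderiv[Icc 0 1] γ s 1‖ₑ
      ≤ ∫⁻ s in Icc (0 : ℝ) 1, ENNReal.ofReal (t * B) := setLIntegral_mono' measurableSet_Icc
          (fun s hs ↦ hspeed s hs)
    _ = ENNReal.ofReal (t * B) := by
        rw [setLIntegral_const, Real.volume_Icc, sub_zero, ENNReal.ofReal_one, mul_one]

variable {ι : Type*} [Fintype ι] (b : Module.Basis ι ℝ E)

omit [FiniteDimensional ℝ E] [I.Boundaryless] in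
set_option backward.isDefEq.respectTransparency false in
/-- **The pulled-back metric in a basis**: for `a ∈ φ.target`, `φ = extChartAt I x₀`, and `w ∈ E`,
`g(D(φ⁻¹)_a w, D(φ⁻¹)_a w) = ∑ᵢⱼ wᵢ wⱼ g(∂ᵢ, ∂ⱼ)(φ⁻¹ a)` with `∂ᵢ = D(φ⁻¹) bᵢ` the coordinate
frame and `wᵢ` the coordinates of `w` in the basis `b`. [folklore] -/
theorem val_mfderivWithin_symm_eq_sum (x₀ : M) {a : E} (ha : a ∈ (extChartAt I x₀).target) (w : E) :
    g.val ((extChartAt I x₀).symm a)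
        (mfderivWithin 𝓘(ℝ, E) I (extChartAt I x₀).symm (range I) a w)
        (mfderivWithin 𝓘(ℝ, E) I (extChartAt I x₀).symm (range I) a w) =
      ∑ i, ∑ j, b.repr w i * b.repr w j *
        g.val ((extChartAt I x₀).symm a)
          ((trivializationAt E (TangentSpace I) x₀).localFrame b i ((extChartAt I x₀).symm a))
          ((trivializationAt E (TangentSpace I) x₀).localFrame b j ((extChartAt I x₀).symm a)) := by
  have hp : (extChartAt I x₀).symm a ∈ (chartAt H x₀).source := by
    rw [← extChartAt_source I]; exact (extChartAt I x₀).map_target ha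
  have hpa : extChartAt I x₀ ((extChartAt I x₀).symm a) = a := (extChartAt I x₀).right_inv ha
  have hframe : ∀ i, (trivializationAt E (TangentSpace I) x₀).localFrame b i
      ((extChartAt I x₀).symm a) =
      mfderivWithin 𝓘(ℝ, E) I (extChartAt I x₀).symm (range I) a (b i) := by
    intro i
    rw [localFrame_apply_eq_mfderivWithin_symm b hp i, hpa]
  set D := mfderivWithin 𝓘(ℝ, E) I (extChartAt I x₀).symm (range I) a with hDdef
  have hw : D w = ∑ i, b.repr w i • D (b i) := by
    conv_lhs => rw [← b.sum_repr w]
    simp only [map_sum, ContinuousLinearMap.map_smul]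
  simp_rw [hframe]
  rw [hw]
  simp only [map_sum, map_smul, FunLike.coe_sum, Finset.sum_apply,
    FunLike.coe_smul, Pi.smul_apply, smul_eq_mul, Finset.mul_sum]
  refine Finset.sum_congr rfl (fun i _ ↦ Finset.sum_congr rfl (fun j _ ↦ ?_))
  rw [g.symm]
  ring

omit [I.Boundaryless] in
set_option backward.isDefEq.respectTransparency false in
/-- **Continuity of the pulled-back metric**: `(a, w) ↦ g(D(φ⁻¹)_a w, D(φ⁻¹)_a w)` is continuous
on `φ.target × E` (the coordinate expression `∑ᵢⱼ wᵢ wⱼ ĝᵢⱼ(a)` with smooth `ĝᵢⱼ`,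
`contDiffOn_gram_comp_extChartAt_symm`). [folklore] -/
theorem continuousOn_val_mfderivWithin_symm (x₀ : M) :
    ContinuousOn (fun q : E × E ↦ g.val ((extChartAt I x₀).symm q.1)
        (mfderivWithin 𝓘(ℝ, E) I (extChartAt I x₀).symm (range I) q.1 q.2)
        (mfderivWithin 𝓘(ℝ, E) I (extChartAt I x₀).symm (range I) q.1 q.2))
      ((extChartAt I x₀).target ×ˢ univ) := by
  classical
  obtain ⟨b⟩ : Nonempty (Module.Basis (Fin (Module.finrank ℝ E)) ℝ E) := ⟨Module.finBasis ℝ E⟩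
  have hG : ∀ i j, ContinuousOn (fun q : E × E ↦ g.val ((extChartAt I x₀).symm q.1)
      ((trivializationAt E (TangentSpace I) x₀).localFrame b i ((extChartAt I x₀).symm q.1))
      ((trivializationAt E (TangentSpace I) x₀).localFrame b j ((extChartAt I x₀).symm q.1)))
      ((extChartAt I x₀).target ×ˢ univ) := fun i j ↦
    ((contDiffOn_gram_comp_extChartAt_symm b g i j).continuousOn).comp continuous_fst.continuousOn
      (fun q hq ↦ hq.1)
  have hc : ∀ i, Continuous (fun q : E × E ↦ b.repr q.2 i) := fun i ↦
    ((b.coord i).continuous_of_finiteDimensional).comp continuous_snd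
  have hsum : ContinuousOn (fun q : E × E ↦ ∑ i, ∑ j, b.repr q.2 i * b.repr q.2 j *
      g.val ((extChartAt I x₀).symm q.1)
        ((trivializationAt E (TangentSpace I) x₀).localFrame b i ((extChartAt I x₀).symm q.1))
        ((trivializationAt E (TangentSpace I) x₀).localFrame b j ((extChartAt I x₀).symm q.1)))
      ((extChartAt I x₀).target ×ˢ univ) :=
    continuousOn_finsetSum _ (fun i _ ↦ continuousOn_finsetSum _ (fun j _ ↦
      (((hc i).continuousOn.mul (hc j).continuousOn)).mul (hG i j)))
  refine hsum.congr (fun q hq ↦ ?_)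
  exact val_mfderivWithin_symm_eq_sum g b x₀ hq.1 q.2

set_option backward.isDefEq.respectTransparency false in
/-- **Local comparison of the pulled-back metrics** (uniform continuity and uniform positivity on
a compact set): for a compact `K ⊆ φ.target` and `η > 0` there is `ε > 0` such that for `y ∈ K`
and `‖a - y‖ ≤ ε` one has `a ∈ φ.target` and
`g(D(φ⁻¹)_a w, D(φ⁻¹)_a w) ≤ (1 + η) g(D(φ⁻¹)_y w, D(φ⁻¹)_y w)` for all `w`. [folklore] -/
theorem exists_forall_val_mfderivWithin_symm_le (hg : g.IsRiemannian) (x₀ : M) {K : Set E}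
    (hK : IsCompact K) (hKt : K ⊆ (extChartAt I x₀).target) {η : ℝ} (hη : 0 < η) :
    ∃ ε > 0, ∀ y ∈ K, ∀ a : E, ‖a - y‖ ≤ ε → a ∈ (extChartAt I x₀).target ∧ ∀ w : E,
      g.val ((extChartAt I x₀).symm a)
          (mfderivWithin 𝓘(ℝ, E) I (extChartAt I x₀).symm (range I) a w)
          (mfderivWithin 𝓘(ℝ, E) I (extChartAt I x₀).symm (range I) a w) ≤
        (1 + η) * g.val ((extChartAt I x₀).symm y)
          (mfderivWithin 𝓘(ℝ, E) I (extChartAt I x₀).symm (range I) y w)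
          (mfderivWithin 𝓘(ℝ, E) I (extChartAt I x₀).symm (range I) y w) := by
  -- notation
  set P : E × E → ℝ := fun q ↦ g.val ((extChartAt I x₀).symm q.1)
      (mfderivWithin 𝓘(ℝ, E) I (extChartAt I x₀).symm (range I) q.1 q.2)
      (mfderivWithin 𝓘(ℝ, E) I (extChartAt I x₀).symm (range I) q.1 q.2) with hP
  have hPc : ContinuousOn P ((extChartAt I x₀).target ×ˢ univ) :=
    continuousOn_val_mfderivWithin_symm g x₀
  have hPsmul : ∀ a (c : ℝ) w, P (a, c • w) = c ^ 2 * P (a, w) := by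
    intro a c w
    simp only [hP, map_smul, FunLike.coe_smul, Pi.smul_apply, smul_eq_mul]
    ring
  have hPnn : ∀ a w, 0 ≤ P (a, w) := by
    intro a w
    simp only [hP]
    by_cases h0 : mfderivWithin 𝓘(ℝ, E) I (extChartAt I x₀).symm (range I) a w = 0
    · rw [h0]; simp
    · exact (hg _ _ h0).le
  -- a compact cthickening of `K` inside the target
  obtain ⟨r, hr, hrK⟩ := hK.exists_cthickening_subset_open (isOpen_extChartAt_target x₀) hKt
  set K' := cthickening r K with hK'
  have hK'c : IsCompact K' := hK.cthickening
  have hball : ∀ y ∈ K, ∀ a, ‖a - y‖ ≤ r → a ∈ K' := fun y hy a ha ↦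
    closedBall_subset_cthickening hy r (mem_closedBall_iff_norm.2 ha)
  -- uniform positivity on `K' × sphere`
  have hpos : ∃ m > 0, ∀ a ∈ K', ∀ w : E, ‖w‖ = 1 → m ≤ P (a, w) := by
    by_cases hS : (K' ×ˢ sphere (0 : E) 1).Nonempty
    · have hSc : IsCompact (K' ×ˢ sphere (0 : E) 1) := hK'c.prod (isCompact_sphere 0 1)
      obtain ⟨q₀, hq₀, hmin⟩ := hSc.exists_isMinOn hS
        (hPc.mono (prod_mono hrK (subset_univ _)))
      refine ⟨P q₀, ?_, fun a ha w hw ↦ hmin ⟨ha, mem_sphere_zero_iff_norm.2 hw⟩⟩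
      simp only [hP]
      have hq₁ : q₀.1 ∈ (extChartAt I x₀).target := hrK hq₀.1
      have hw0 : q₀.2 ≠ 0 := by
        have : ‖q₀.2‖ = 1 := mem_sphere_zero_iff_norm.1 hq₀.2
        intro h; rw [h, norm_zero] at this; exact zero_ne_one this
      refine hg _ _ (fun h0 ↦ hw0 ?_)
      refine (isInvertible_mfderivWithin_extChartAt_symm hq₁).injective ?_
      rw [h0]
      exact (ContinuousLinearMap.map_zero _).symm
    · refine ⟨1, one_pos, fun a ha w hw ↦ ?_⟩
      exact (hS ⟨(a, w), ha, mem_sphere_zero_iff_norm.2 hw⟩).elim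
  obtain ⟨m, hm, hmP⟩ := hpos
  -- uniform continuity on `K' × closedBall 0 1`
  have hUc : UniformContinuousOn P (K' ×ˢ closedBall (0 : E) 1) :=
    (hK'c.prod (isCompact_closedBall 0 1)).uniformContinuousOn_of_continuous
      (hPc.mono (prod_mono hrK (subset_univ _)))
  obtain ⟨δ₀, hδ₀, hδP⟩ := Metric.uniformContinuousOn_iff.1 hUc (m * η) (by positivity)
  refine ⟨min r (δ₀ / 2), by positivity, fun y hy a ha ↦ ?_⟩
  have har : ‖a - y‖ ≤ r := ha.trans (min_le_left _ _)
  have haδ : ‖a - y‖ < δ₀ := by linarith [ha.trans (min_le_right _ _)]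
  have haK' : a ∈ K' := hball y hy a har
  have hyK' : y ∈ K' := self_subset_cthickening K hy
  refine ⟨hrK haK', fun w ↦ ?_⟩
  -- reduce to unit vectors
  by_cases hw : w = 0
  · subst hw
    have h0 : ∀ a', P (a', 0) = 0 := fun a' ↦ by
      simpa using hPsmul a' 0 0
    show P (a, 0) ≤ (1 + η) * P (y, 0)
    rw [h0, h0, mul_zero]
  · set u : E := ‖w‖⁻¹ • w with hu
    have hnw : 0 < ‖w‖ := norm_pos_iff.2 hw
    have hu1 : ‖u‖ = 1 := by rw [hu, norm_smul, norm_inv, norm_norm, inv_mul_cancel₀ hnw.ne']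
    have hwu : w = ‖w‖ • u := by rw [hu, smul_smul, mul_inv_cancel₀ hnw.ne', one_smul]
    clear_value u
    have hunit : P (a, u) ≤ (1 + η) * P (y, u) := by
      have hd : dist (a, u) (y, u) < δ₀ := by
        rw [Prod.dist_eq, dist_self, dist_eq_norm]
        exact max_lt haδ hδ₀
      have h1 := hδP (a, u) ⟨haK', mem_closedBall_zero_iff.2 hu1.le⟩ (y, u)
        ⟨hyK', mem_closedBall_zero_iff.2 hu1.le⟩ hd
      rw [Real.dist_eq] at h1
      have h2 : m ≤ P (y, u) := hmP y hyK' u hu1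
      have h3 : P (a, u) ≤ P (y, u) + m * η := by linarith [(abs_lt.1 h1).2]
      calc P (a, u) ≤ P (y, u) + m * η := h3
        _ ≤ P (y, u) + P (y, u) * η := by gcongr
        _ = (1 + η) * P (y, u) := by ring
    show P (a, w) ≤ (1 + η) * P (y, w)
    rw [hwu, hPsmul, hPsmul]
    calc ‖w‖ ^ 2 * P (a, u) ≤ ‖w‖ ^ 2 * ((1 + η) * P (y, u)) := by gcongr
      _ = (1 + η) * (‖w‖ ^ 2 * P (y, u)) := by ring

end Chart

/-! ### Pointwise gradient bounds from bounds on the differential -/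

section GradBounds

variable {E : Type*} [NormedAddCommGroup E] [NormedSpace ℝ E] [FiniteDimensional ℝ E]
  {H : Type*} [TopologicalSpace H] {I : ModelWithCorners ℝ E H}
  {M : Type*} [TopologicalSpace M] [ChartedSpace H M] [IsManifold I ∞ M]
  (g : PseudoRiemannianMetric I ∞ E (TangentSpace I : M → Type _))

/-- **Cauchy–Schwarz for the differential**: `|dψ_x(v)| ≤ |∇ψ|_g(x) · |v|_g` for a Riemannian
`g` (`dψ(v) = g(♯dψ, v)`, `|♯dψ|² = g⁻¹(dψ, dψ) = |∇ψ|²`). [folklore] -/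
theorem abs_mvfderiv_le_sqrt_gradSq_mul_sqrt (hg : g.IsRiemannian) (ψ : M → ℝ) (x : M)
    (v : TangentSpace I x) :
    |mvfderiv I ψ x v| ≤ Real.sqrt (g.gradSq ψ x) * Real.sqrt (g.val x v v) := by
  letI := g.riemannianBundle hg
  set α : Module.Dual ℝ (TangentSpace I x) := (mvfderiv I ψ x : TangentSpace I x →ₗ[ℝ] ℝ)
  have h1 : mvfderiv I ψ x v = g.val x (g.sharp x α) v := by
    rw [PseudoRiemannianMetric.val_sharp_apply]; rfl
  have h2 : g.gradSq ψ x = g.val x (g.sharp x α) (g.sharp x α) := by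
    rw [PseudoRiemannianMetric.gradSq, PseudoRiemannianMetric.innerDual_eq_val_sharp_sharp]
  rw [h1, h2, ← g.inner_eq hg, ← g.inner_eq hg, ← g.inner_eq hg, real_inner_self_eq_norm_sq,
    real_inner_self_eq_norm_sq, Real.sqrt_sq (norm_nonneg _), Real.sqrt_sq (norm_nonneg _)]
  exact abs_real_inner_le_norm _ _

/-- **From a bound on the differential to a bound on the gradient square**: if
`|dχ_x(v)| ≤ A |v|_g` for all `v` (`A ≥ 0`), then `|∇χ|²_g(x) ≤ A²` (test on `v = ♯dχ`).
[folklore] -/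
theorem gradSq_le_sq_of_forall_abs_mvfderiv_le (hg : g.IsRiemannian) {χ : M → ℝ} {x : M}
    {A : ℝ} (hA : 0 ≤ A) (h : ∀ v : TangentSpace I x, |mvfderiv I χ x v| ≤ A * Real.sqrt (g.val x v v)) :
    g.gradSq χ x ≤ A ^ 2 := by
  set α : Module.Dual ℝ (TangentSpace I x) := (mvfderiv I χ x : TangentSpace I x →ₗ[ℝ] ℝ)
  set sv := g.sharp x α with hsv
  have hG : g.gradSq χ x = g.val x sv sv := by
    rw [PseudoRiemannianMetric.gradSq, PseudoRiemannianMetric.innerDual_eq_val_sharp_sharp]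
  have hG' : mvfderiv I χ x sv = g.gradSq χ x := by
    rw [hG, hsv, PseudoRiemannianMetric.val_sharp_apply]; rfl
  have hnn : 0 ≤ g.gradSq χ x := by
    rw [hG]
    by_cases h0 : sv = 0
    · rw [h0]; simp
    · exact (hg x sv h0).le
  have key : g.gradSq χ x ≤ A * Real.sqrt (g.gradSq χ x) := by
    have := h sv
    rwa [hG', abs_of_nonneg hnn, ← hG] at this
  -- `G ≤ A √G` gives `√G ≤ A`, i.e. `G ≤ A²`
  have hsq : Real.sqrt (g.gradSq χ x) ≤ A := by
    by_contra hlt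
    push Not at hlt
    have hpos : 0 < Real.sqrt (g.gradSq χ x) := hA.trans_lt hlt
    have : Real.sqrt (g.gradSq χ x) * Real.sqrt (g.gradSq χ x) ≤ A * Real.sqrt (g.gradSq χ x) := by
      rw [Real.mul_self_sqrt hnn]; exact key
    have := le_of_mul_le_mul_right this hpos
    linarith
  calc g.gradSq χ x = Real.sqrt (g.gradSq χ x) ^ 2 := (Real.sq_sqrt hnn).symm
    _ ≤ A ^ 2 := by gcongr

end GradBounds

/-! ### The local estimate: mollifying a Lipschitz function in a chart -/

section LocalEstimate

variable {E : Type*} [NormedAddCommGroup E] [NormedSpace ℝ E] [FiniteDimensional ℝ E]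
  [MeasurableSpace E] [BorelSpace E] {μ : Measure E} [μ.IsAddHaarMeasure]
  {H : Type*} [TopologicalSpace H] {I : ModelWithCorners ℝ E H}
  {M : Type*} [TopologicalSpace M] [ChartedSpace H M] [IsManifold I ∞ M]
  (g : PseudoRiemannianMetric I ∞ E (TangentSpace I : M → Type _))

/-- **Directional derivative bound for the chart mollification of a Lipschitz function.** Let
`F : M → ℝ` satisfy `|F x - F y| ≤ L d_g(x, y)`, let `φ = extChartAt I x₀`, `Ĝ` a locally
integrable function on `E` agreeing with `F ∘ φ⁻¹` on `φ.target`, `ψ` a bump with outer radius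
`R`, and `y, w ∈ E` with `B(y, 2R) ⊆ φ.target` and `g(D(φ⁻¹)_a w, D(φ⁻¹)_a w) ≤ S²` on `B(y, 2R)`.
Then `|D(ψ ⋆ Ĝ)(y) w| ≤ L S`: increments of `Ĝ` along `w` inside `B(y, 2R)` are bounded by `L S |t|`
through the length of chart segments (`edist_symm_le_of_forall_val_le`). [folklore] -/
theorem abs_fderiv_mollify_le (hg : g.IsRiemannian) (x₀ : M) {F : M → ℝ} {L : ℝ} (hL : 0 ≤ L)
    (hF : ∀ x y, ENNReal.ofReal |F x - F y| ≤ ENNReal.ofReal L * g.edist hg x y)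
    (ψ : ContDiffBump (0 : E)) {Ĝ : E → ℝ} (hĜi : LocallyIntegrable Ĝ μ)
    (hĜ : ∀ a ∈ (extChartAt I x₀).target, Ĝ a = F ((extChartAt I x₀).symm a))
    {y w : E} {S : ℝ} (hS : 0 ≤ S) (hball : ball y (2 * ψ.rOut) ⊆ (extChartAt I x₀).target)
    (hSw : ∀ a ∈ ball y (2 * ψ.rOut), g.val ((extChartAt I x₀).symm a)
        (mfderivWithin 𝓘(ℝ, E) I (extChartAt I x₀).symm (range I) a w)
        (mfderivWithin 𝓘(ℝ, E) I (extChartAt I x₀).symm (range I) a w) ≤ S ^ 2) :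
    |fderiv ℝ (ψ.normed μ ⋆[ContinuousLinearMap.lsmul ℝ ℝ, μ] Ĝ) y w| ≤ L * S := by
  have hR := ψ.rOut_pos
  -- increments along `w` of length `< R` starting in `B(y, R)` stay in `B(y, 2R)`
  set δ : ℝ := ψ.rOut / (‖w‖ + 1) with hδ
  have hδpos : 0 < δ := by positivity
  have hsmall : ∀ t : ℝ, |t| < δ → ‖t • w‖ < ψ.rOut := by
    intro t ht
    rw [norm_smul, Real.norm_eq_abs]
    have h1 : |t| * (‖w‖ + 1) < ψ.rOut := by rwa [hδ, lt_div_iff₀ (by positivity)] at ht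
    nlinarith [abs_nonneg t, norm_nonneg w]
  -- the key increment bound, for a segment `[a, a + τ w]`, `τ ≥ 0`, inside `B(y, 2R)`
  have hinc : ∀ (a : E) (τ : ℝ), 0 ≤ τ → a ∈ ball y (2 * ψ.rOut) → a + τ • w ∈ ball y (2 * ψ.rOut) →
      |F ((extChartAt I x₀).symm (a + τ • w)) - F ((extChartAt I x₀).symm a)| ≤ L * S * τ := by
    intro a τ hτ ha haτ
    have hconv : Convex ℝ (ball y (2 * ψ.rOut)) := convex_ball _ _
    have hsegB : segment ℝ a (a + τ • w) ⊆ ball y (2 * ψ.rOut) := hconv.segment_subset ha haτ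
    have hD : ∀ u ∈ Icc (0 : ℝ) τ, g.val ((extChartAt I x₀).symm (a + u • w))
        (mfderivWithin 𝓘(ℝ, E) I (extChartAt I x₀).symm (range I) (a + u • w) w)
        (mfderivWithin 𝓘(ℝ, E) I (extChartAt I x₀).symm (range I) (a + u • w) w) ≤ S ^ 2 := by
      intro u hu
      refine hSw _ ?_
      rcases eq_or_lt_of_le hτ with h0 | hpos
      · have hu0 : u = 0 := le_antisymm (h0 ▸ hu.2) hu.1
        simpa [hu0] using ha
      · have heq : a + u • w = a + (u / τ) • (τ • w) := by
          rw [smul_smul, div_mul_cancel₀ u hpos.ne']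
        rw [heq]
        exact hconv.add_smul_mem ha (by simpa using haτ)
          ⟨div_nonneg hu.1 hτ, (div_le_one hpos).2 hu.2⟩
    have hedist := edist_symm_le_of_forall_val_le g hg x₀ hτ hS (hsegB.trans hball) hD
    have h1 := hF ((extChartAt I x₀).symm (a + τ • w)) ((extChartAt I x₀).symm a)
    rw [PseudoRiemannianMetric.edist_comm] at h1
    have h2 : ENNReal.ofReal |F ((extChartAt I x₀).symm (a + τ • w)) -
        F ((extChartAt I x₀).symm a)| ≤ ENNReal.ofReal (L * (τ * S)) := by
      rw [ENNReal.ofReal_mul hL]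
      exact h1.trans (mul_le_mul_right hedist _)
    have h3 := (ENNReal.ofReal_le_ofReal_iff (by positivity)).1 h2
    linarith [h3]
  -- feed the increment bound into the derivative bound for mollifications
  refine abs_fderiv_normed_convolution_apply_le ψ hĜi (B := L * S) (δ := δ) (by positivity)
    hδpos (fun t ht a ha ↦ ?_)
  have ha2 : a ∈ ball y (2 * ψ.rOut) := by
    rw [mem_ball] at ha ⊢; linarith
  have hat : a + t • w ∈ ball y (2 * ψ.rOut) := by
    rw [mem_ball, dist_eq_norm] at ha ⊢
    calc ‖a + t • w - y‖ = ‖(a - y) + t • w‖ := by abel_nf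
      _ ≤ ‖a - y‖ + ‖t • w‖ := norm_add_le _ _
      _ < ψ.rOut + ψ.rOut := add_lt_add ha (hsmall t ht)
      _ = 2 * ψ.rOut := by ring
  rw [hĜ _ (hball hat), hĜ _ (hball ha2)]
  rcases le_or_gt 0 t with ht0 | ht0
  · rw [abs_of_nonneg ht0]
    exact hinc a t ht0 ha2 hat
  · set a' := a + t • w with ha'
    have haa : a = a' + (-t) • w := by rw [ha', neg_smul, add_neg_cancel_right]
    have h := hinc a' (-t) (by linarith) hat (by rw [← haa]; exact ha2)
    rw [← haa] at h
    rw [abs_sub_comm, abs_of_neg ht0]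
    exact h

end LocalEstimate

/-! ### From the chart to the manifold -/

section ChartToManifold

variable {E : Type*} [NormedAddCommGroup E] [NormedSpace ℝ E] [FiniteDimensional ℝ E]
  {H : Type*} [TopologicalSpace H] {I : ModelWithCorners ℝ E H} [I.Boundaryless]
  {M : Type*} [TopologicalSpace M] [ChartedSpace H M] [IsManifold I ∞ M]
  (g : PseudoRiemannianMetric I ∞ E (TangentSpace I : M → Type _))

omit [FiniteDimensional ℝ E] in
set_option backward.isDefEq.respectTransparency false in
/-- **Differential of a chart representative.** For `Φ : E → ℝ` differentiable at `φ x`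
(`φ = extChartAt I x₀`, `x` in the chart domain): if `|DΦ(φ x) w| ≤ C |D(φ⁻¹)_{φ x} w|_g` for
all `w ∈ E`, then `|d(Φ ∘ φ)_x(u)| ≤ C |u|_g` for all tangent vectors `u` (every `u` is
`D(φ⁻¹)_{φ x} (Dφ_x u)`). [folklore] -/
theorem abs_mvfderiv_comp_extChartAt_le (x₀ : M) {Φ : E → ℝ} {x : M}
    (hx : x ∈ (chartAt H x₀).source) (hΦ : DifferentiableAt ℝ Φ (extChartAt I x₀ x)) {C : ℝ}
    (hD : ∀ w : E, |fderiv ℝ Φ (extChartAt I x₀ x) w| ≤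
      C * Real.sqrt (g.val ((extChartAt I x₀).symm (extChartAt I x₀ x))
        (mfderivWithin 𝓘(ℝ, E) I (extChartAt I x₀).symm (range I) (extChartAt I x₀ x) w)
        (mfderivWithin 𝓘(ℝ, E) I (extChartAt I x₀).symm (range I) (extChartAt I x₀ x) w)))
    (u : TangentSpace I x) :
    |mvfderiv I (Φ ∘ extChartAt I x₀) x u| ≤ C * Real.sqrt (g.val x u u) := by
  have hxs : x ∈ (extChartAt I x₀).source := by rwa [extChartAt_source]
  have hxx : (extChartAt I x₀).symm (extChartAt I x₀ x) = x := (extChartAt I x₀).left_inv hxs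
  set w : E := mfderiv I 𝓘(ℝ, E) (extChartAt I x₀) x u with hw
  -- `u = D(φ⁻¹)(φ x) w`
  have hu : mfderivWithin 𝓘(ℝ, E) I (extChartAt I x₀).symm (range I) (extChartAt I x₀ x) w = u := by
    have h := mfderivWithin_extChartAt_symm_comp_mfderiv_extChartAt' (I := I) hxs
    have := congr($h u)
    simpa [hw] using this
  -- the chart representative is differentiable at `x`, with `(Φ ∘ φ) ∘ φ⁻¹ = Φ` near `φ x`
  have hF : MDifferentiableAt I 𝓘(ℝ, ℝ) (Φ ∘ extChartAt I x₀) x :=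
    (hΦ.hasFDerivAt.hasMFDerivAt.comp x (hasMFDerivAt_extChartAt (I := I) hx)).mdifferentiableAt
  have hev : (Φ ∘ extChartAt I x₀) ∘ (extChartAt I x₀).symm =ᶠ[𝓝 (extChartAt I x₀ x)] Φ := by
    filter_upwards [(isOpen_extChartAt_target x₀).mem_nhds ((extChartAt I x₀).map_source hxs)]
      with a ha
    show Φ (extChartAt I x₀ ((extChartAt I x₀).symm a)) = Φ a
    rw [(extChartAt I x₀).right_inv ha]
  have hkey := mvfderiv_apply_mfderivWithin_symm (I := I) hx hF w
  rw [hev.fderiv_eq, hu] at hkey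
  rw [hkey]
  have := hD w
  rwa [hu, hxx] at this

/-- **Chart-local smoothing of a Lipschitz function with sharp gradient control.** Let `g` be
Riemannian on a compact manifold, `F : M → ℝ` continuous with `|F x - F y| ≤ L d_g(x, y)`,
`φ = extChartAt I x₀`, `K` a compact subset of the chart domain and `η₁, η₂ > 0`. Then there is
a smooth `Φ : E → ℝ` (a mollification `ψ_R ⋆ (F ∘ φ⁻¹)` at a small scale `R`) with
`|Φ(φ x) - F x| ≤ η₁` and `|d(Φ ∘ φ)_x u| ≤ L (1 + η₂) |u|_g` for `x ∈ K`: mollification in a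
chart does not increase the Lipschitz constant, up to the oscillation of the pulled-back metric
at scale `R` (`exists_forall_val_mfderivWithin_symm_le`, `abs_fderiv_mollify_le`). [folklore] -/
theorem exists_contDiff_chart_smoothing [CompactSpace M] (hg : g.IsRiemannian) (x₀ : M)
    {F : M → ℝ} (hFc : Continuous F) {L : ℝ} (hL : 0 ≤ L)
    (hF : ∀ x y, ENNReal.ofReal |F x - F y| ≤ ENNReal.ofReal L * g.edist hg x y)
    {K : Set M} (hK : IsCompact K) (hKs : K ⊆ (chartAt H x₀).source) {η₁ η₂ : ℝ}
    (hη₁ : 0 < η₁) (hη₂ : 0 < η₂) :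
    ∃ Φ : E → ℝ, ContDiff ℝ ∞ Φ ∧ (∀ x ∈ K, |Φ (extChartAt I x₀ x) - F x| ≤ η₁) ∧
      ∀ x ∈ K, ∀ u : TangentSpace I x,
        |mvfderiv I (Φ ∘ extChartAt I x₀) x u| ≤ L * (1 + η₂) * Real.sqrt (g.val x u u) := by
  classical
  letI : MeasurableSpace E := borel E
  haveI : BorelSpace E := ⟨rfl⟩
  set μ : Measure E := Measure.addHaar with hμ
  set φ := extChartAt I x₀ with hφ
  have hKs' : K ⊆ φ.source := by rwa [hφ, extChartAt_source]
  -- the compact image of `K` in the chart and a compact cthickening inside the target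
  set Kc : Set E := φ '' K with hKc
  have hKcc : IsCompact Kc := hK.image_of_continuousOn ((continuousOn_extChartAt x₀).mono hKs')
  have hKct : Kc ⊆ φ.target := by
    rintro _ ⟨x, hx, rfl⟩; exact φ.map_source (hKs' hx)
  obtain ⟨r, hr, hrK⟩ := hKcc.exists_cthickening_subset_open (isOpen_extChartAt_target x₀) hKct
  set K' : Set E := cthickening r Kc with hK'
  have hK'c : IsCompact K' := hKcc.cthickening
  -- (i) comparison of the pulled-back metrics near `Kc`
  obtain ⟨ε₁, hε₁, hcomp⟩ := exists_forall_val_mfderivWithin_symm_le g hg x₀ hKcc hKct hη₂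
  -- (ii) uniform continuity of `F ∘ φ⁻¹` on `K'`
  have hFsc : ContinuousOn (F ∘ φ.symm) K' :=
    (hFc.comp_continuousOn (continuousOn_extChartAt_symm x₀)).mono hrK
  obtain ⟨δ₁, hδ₁, hUC⟩ := Metric.uniformContinuousOn_iff.1
    (hK'c.uniformContinuousOn_of_continuous hFsc) η₁ hη₁
  -- the smoothing scale and the bump
  set R : ℝ := min (ε₁ / 2) (min r δ₁) / 2 with hR
  have hRpos : 0 < R := by positivity
  have hRε : 2 * R ≤ ε₁ / 2 := by
    have : min (ε₁ / 2) (min r δ₁) ≤ ε₁ / 2 := min_le_left _ _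
    rw [hR]; linarith
  have hRr : R ≤ r / 2 := by
    have : min (ε₁ / 2) (min r δ₁) ≤ r := (min_le_right _ _).trans (min_le_left _ _)
    rw [hR]; linarith
  have hRδ : R ≤ δ₁ / 2 := by
    have : min (ε₁ / 2) (min r δ₁) ≤ δ₁ := (min_le_right _ _).trans (min_le_right _ _)
    rw [hR]; linarith
  let ψ : ContDiffBump (0 : E) := ⟨R / 2, R, by positivity, by linarith⟩
  have hψR : ψ.rOut = R := rfl
  -- the representative `Ĝ = 𝟙_target · F ∘ φ⁻¹`, bounded and measurable, hence locally integrable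
  set Ĝ : E → ℝ := φ.target.indicator (F ∘ φ.symm) with hĜdef
  have hĜ : ∀ a ∈ φ.target, Ĝ a = F (φ.symm a) := fun a ha ↦ by
    simp [hĜdef, indicator_of_mem ha]
  obtain ⟨CF, hCF⟩ : ∃ C, ∀ x, ‖F x‖ ≤ C := by
    obtain ⟨C, hC⟩ := isCompact_univ.exists_bound_of_continuousOn hFc.continuousOn
    exact ⟨C, fun x ↦ hC x (mem_univ x)⟩
  have hĜb : ∀ a, ‖Ĝ a‖ ≤ max CF 0 := by
    intro a
    by_cases ha : a ∈ φ.target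
    · rw [hĜ a ha]; exact (hCF _).trans (le_max_left _ _)
    · simp [hĜdef, indicator_of_notMem ha]
  have hĜm : AEStronglyMeasurable Ĝ μ := by
    rw [hĜdef, aestronglyMeasurable_indicator_iff (isOpen_extChartAt_target x₀).measurableSet]
    exact (hFc.comp_continuousOn (continuousOn_extChartAt_symm x₀)).aestronglyMeasurable
      (isOpen_extChartAt_target x₀).measurableSet
  have hĜi : LocallyIntegrable Ĝ μ := by
    refine (locallyIntegrable_iff).2 (fun C hC ↦ ?_)
    exact Measure.integrableOn_of_bounded hC.measure_lt_top.ne hĜm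
      (Eventually.of_forall fun a ↦ hĜb a)
  -- the mollification
  set Φ : E → ℝ := ψ.normed μ ⋆[ContinuousLinearMap.lsmul ℝ ℝ, μ] Ĝ with hΦ
  have hΦs : ContDiff ℝ ∞ Φ :=
    ψ.hasCompactSupport_normed.contDiff_convolution_left _ ψ.contDiff_normed hĜi
  refine ⟨Φ, hΦs, fun x hx ↦ ?_, fun x hx u ↦ ?_⟩
  · -- closeness: `|Φ(φ x) - F x| ≤ η₁` by uniform continuity at scale `R ≤ δ₁/2`
    have hy : φ x ∈ Kc := mem_image_of_mem _ hx
    have hyK' : φ x ∈ K' := self_subset_cthickening _ hy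
    have hclose : ∀ y' ∈ ball (φ x) ψ.rOut, dist (Ĝ y') (Ĝ (φ x)) ≤ η₁ := by
      intro y' hy'
      rw [hψR] at hy'
      have hy'K' : y' ∈ K' := closedBall_subset_cthickening hy r
        (mem_closedBall.2 (by rw [mem_ball] at hy'; linarith))
      rw [hĜ y' (hrK hy'K'), hĜ _ (hrK hyK')]
      refine (hUC y' hy'K' (φ x) hyK' ?_).le
      rw [mem_ball] at hy'; linarith
    have h := ContDiffBump.dist_normed_convolution_le (φ := ψ) (μ := μ) hĜm hclose
    rw [Real.dist_eq, hĜ _ (hrK hyK'), show φ.symm (φ x) = x from φ.left_inv (hKs' hx)] at h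
    exact h
  · -- the differential: `abs_fderiv_mollify_le` with `S² = (1 + η₂) g(D(φ⁻¹) w, D(φ⁻¹) w)`
    have hy : φ x ∈ Kc := mem_image_of_mem _ hx
    have hball : ball (φ x) (2 * ψ.rOut) ⊆ φ.target := by
      intro a ha
      rw [hψR, mem_ball, dist_eq_norm] at ha
      exact (hcomp (φ x) hy a (by linarith)).1
    refine abs_mvfderiv_comp_extChartAt_le g x₀ (hKs hx)
      ((hΦs.differentiable (by simp)) _) (fun w ↦ ?_) u
    set P₀ : ℝ := g.val (φ.symm (φ x))
      (mfderivWithin 𝓘(ℝ, E) I φ.symm (range I) (φ x) w)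
      (mfderivWithin 𝓘(ℝ, E) I φ.symm (range I) (φ x) w) with hP₀
    have hP₀nn : 0 ≤ P₀ := by
      rw [hP₀]
      by_cases h0 : mfderivWithin 𝓘(ℝ, E) I φ.symm (range I) (φ x) w = 0
      · rw [h0]; simp
      · exact (hg _ _ h0).le
    set S : ℝ := Real.sqrt ((1 + η₂) * P₀) with hS
    have hSw : ∀ a ∈ ball (φ x) (2 * ψ.rOut), g.val (φ.symm a)
        (mfderivWithin 𝓘(ℝ, E) I φ.symm (range I) a w)
        (mfderivWithin 𝓘(ℝ, E) I φ.symm (range I) a w) ≤ S ^ 2 := by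
      intro a ha
      rw [hψR, mem_ball, dist_eq_norm] at ha
      rw [hS, Real.sq_sqrt (by positivity)]
      exact (hcomp (φ x) hy a (by linarith)).2 w
    have hmain := abs_fderiv_mollify_le g hg x₀ hL hF ψ hĜi hĜ (Real.sqrt_nonneg _) hball hSw
    refine hmain.trans ?_
    -- `L √((1+η₂) P₀) ≤ L (1+η₂) √P₀`
    rw [Real.sqrt_mul (by positivity), mul_assoc]
    gcongr
    rw [Real.sqrt_le_iff]
    exact ⟨by positivity, by nlinarith⟩

end ChartToManifold

/-! ### Global smoothing by a partition of unity -/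

section Global

variable {E : Type*} [NormedAddCommGroup E] [NormedSpace ℝ E] [FiniteDimensional ℝ E]
  {H : Type*} [TopologicalSpace H] {I : ModelWithCorners ℝ E H} [I.Boundaryless]
  {M : Type*} [TopologicalSpace M] [T2Space M] [CompactSpace M] [ChartedSpace H M]
  [IsManifold I ∞ M]
  (g : PseudoRiemannianMetric I ∞ E (TangentSpace I : M → Type _))

/-- **Smooth approximation of Lipschitz functions with gradient control** (Greene–Wu; Azagra–
Ferrera–López-Mesas–Rangel 2007, Thm. 1, compact case). Let `g` be a smooth Riemannian metric on a
closed manifold and `F : M → ℝ` continuous with `|F x - F y| ≤ L d_g(x, y)` (`d_g` the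
Riemannian distance, `L ≥ 0`). Then for every `ε > 0` there is a smooth `χ : M → ℝ` with
`|χ - F| < ε` and `|∇χ|²_g ≤ (L + ε)²` everywhere. Construction: a finite atlas `{φᵢ}`, a smooth
partition of unity `{ρᵢ}` subordinate to it, chart mollifications `Φᵢ` of `F ∘ φᵢ⁻¹` at small
scales (`exists_contDiff_chart_smoothing`), and `χ = ∑ᵢ ρᵢ · (Φᵢ ∘ φᵢ)`; in
`dχ = ∑ᵢ (Φᵢ ∘ φᵢ - F) dρᵢ + ∑ᵢ ρᵢ d(Φᵢ ∘ φᵢ)` (using `∑ᵢ dρᵢ = 0`) the first sum is small and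
the second is a convex combination of covectors of norm `≤ L(1 + η)`.
[cite: AzagraEtAl2007, Thm. 1] -/
theorem exists_contMDiff_abs_sub_lt_gradSq_le (hg : g.IsRiemannian) {F : M → ℝ}
    (hFc : Continuous F) {L : ℝ} (hL : 0 ≤ L)
    (hF : ∀ x y, ENNReal.ofReal |F x - F y| ≤ ENNReal.ofReal L * g.edist hg x y)
    {ε : ℝ} (hε : 0 < ε) :
    ∃ χ : M → ℝ, ContMDiff I 𝓘(ℝ, ℝ) ∞ χ ∧ (∀ x, |χ x - F x| < ε) ∧
      ∀ x, g.gradSq χ x ≤ (L + ε) ^ 2 := by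
  classical
  -- Step 1: finite atlas and a smooth partition of unity subordinate to it
  obtain ⟨t, ht⟩ := CompactSpace.elim_nhds_subcover (fun x : M ↦ (chartAt H x).source)
    (fun x ↦ (chartAt H x).open_source.mem_nhds (mem_chart_source H x))
  obtain ⟨ρ, hρ⟩ := SmoothPartitionOfUnity.exists_isSubordinate I isClosed_univ
    (fun i : t ↦ (chartAt H (i : M)).source) (fun i ↦ (chartAt H (i : M)).open_source) (by
      intro p _
      have hp : p ∈ ⋃ x ∈ t, (chartAt H x).source := by rw [ht]; trivial
      simp only [mem_iUnion] at hp ⊢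
      obtain ⟨x, hx, hpx⟩ := hp
      exact ⟨⟨x, hx⟩, hpx⟩)
  have hsum : ∀ p, ∑ i, ρ i p = 1 := fun p ↦ by
    rw [← finsum_eq_sum_of_fintype]
    exact ρ.sum_eq_one (mem_univ p)
  have hρs : ∀ i, ContMDiff I 𝓘(ℝ, ℝ) ∞ (ρ i) := fun i ↦ (ρ i).contMDiff
  have hρc : ∀ i, IsCompact (tsupport (ρ i)) := fun i ↦ (isClosed_tsupport _).isCompact
  have hρd : ∀ i x, MDifferentiableAt I 𝓘(ℝ, ℝ) (ρ i) x := fun i x ↦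
    ((hρs i) x).mdifferentiableAt (by simp)
  -- Step 2: a uniform bound for the differentials of the `ρ i`
  have hDi : ∀ i, ∃ D : ℝ, 0 ≤ D ∧ ∀ x (v : TangentSpace I x),
      |mvfderiv I (ρ i) x v| ≤ D * Real.sqrt (g.val x v v) := by
    intro i
    have hc : Continuous (g.gradSq (ρ i)) :=
      continuous_innerDual_mvfderiv g ((hρs i).of_le (by norm_num)) ((hρs i).of_le (by norm_num))
    obtain ⟨B, hB⟩ := isCompact_univ.exists_bound_of_continuousOn hc.continuousOn
    refine ⟨Real.sqrt B, Real.sqrt_nonneg _, fun x v ↦ ?_⟩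
    refine (abs_mvfderiv_le_sqrt_gradSq_mul_sqrt g hg (ρ i) x v).trans ?_
    gcongr
    exact (le_abs_self _).trans (by simpa [Real.norm_eq_abs] using hB x (mem_univ x))
  choose D hD0 hD using hDi
  set Dt : ℝ := ∑ i, D i with hDt
  have hDt0 : 0 ≤ Dt := Finset.sum_nonneg (fun i _ ↦ hD0 i)
  -- accuracies
  set η₁ : ℝ := ε / (2 * (Dt + 1)) with hη₁
  have hη₁pos : 0 < η₁ := by positivity
  have hη₁D : η₁ * Dt ≤ ε / 2 := by
    rw [hη₁, div_mul_eq_mul_div, div_le_div_iff₀ (by positivity) (by positivity)]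
    nlinarith
  have hη₁ε : η₁ < ε := by
    rw [hη₁, div_lt_iff₀ (by positivity)]
    nlinarith
  set η₂ : ℝ := ε / (2 * (L + 1)) with hη₂
  have hη₂pos : 0 < η₂ := by positivity
  have hη₂L : L * η₂ ≤ ε / 2 := by
    rw [hη₂, mul_div_assoc', div_le_div_iff₀ (by positivity) (by positivity)]
    nlinarith
  -- Step 3: chart-local smoothings on the supports of the `ρ i`
  have hchart : ∀ i : t, ∃ Φ : E → ℝ, ContDiff ℝ ∞ Φ ∧
      (∀ x ∈ tsupport (ρ i), |Φ (extChartAt I (i : M) x) - F x| ≤ η₁) ∧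
      ∀ x ∈ tsupport (ρ i), ∀ u : TangentSpace I x,
        |mvfderiv I (Φ ∘ extChartAt I (i : M)) x u| ≤ L * (1 + η₂) * Real.sqrt (g.val x u u) :=
    fun i ↦ exists_contDiff_chart_smoothing g hg (i : M) hFc hL hF (hρc i) (hρ i) hη₁pos hη₂pos
  choose Φ hΦs hΦF hΦD using hchart
  -- Step 4: the approximation `χ = ∑ ρᵢ · (Φᵢ ∘ φᵢ)`
  set Ψ : t → M → ℝ := fun i x ↦ Φ i (extChartAt I (i : M) x) with hΨ
  have hΨs : ∀ i, ∀ x ∈ tsupport (ρ i), ContMDiffAt I 𝓘(ℝ, ℝ) ∞ (Ψ i) x := fun i x hx ↦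
    (hΦs i).contDiffAt.comp_contMDiffAt (contMDiffAt_extChartAt' (hρ i hx))
  have hterm : ∀ i, ContMDiff I 𝓘(ℝ, ℝ) ∞ (fun x ↦ ρ i x * Ψ i x) := fun i ↦
    ρ.contMDiff_smul (hΨs i)
  have htermd : ∀ i x, MDifferentiableAt I 𝓘(ℝ, ℝ) (fun x ↦ ρ i x * Ψ i x) x := fun i x ↦
    ((hterm i) x).mdifferentiableAt (by simp)
  refine ⟨fun x ↦ ∑ i, ρ i x * Ψ i x, contMDiff_finsetSum (fun i _ ↦ hterm i), fun x ↦ ?_,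
    fun x ↦ ?_⟩
  · -- closeness
    have heq : (∑ i, ρ i x * Ψ i x) - F x = ∑ i, ρ i x * (Ψ i x - F x) := by
      simp only [mul_sub, Finset.sum_sub_distrib, ← Finset.sum_mul, hsum x, one_mul]
    rw [heq]
    calc |∑ i, ρ i x * (Ψ i x - F x)| ≤ ∑ i, |ρ i x * (Ψ i x - F x)| :=
          Finset.abs_sum_le_sum_abs _ _
      _ ≤ ∑ i, ρ i x * η₁ := Finset.sum_le_sum (fun i _ ↦ ?_)
      _ = η₁ := by rw [← Finset.sum_mul, hsum x, one_mul]
      _ < ε := hη₁ε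
    rw [abs_mul, abs_of_nonneg (ρ.nonneg i x)]
    by_cases hx : x ∈ tsupport (ρ i)
    · exact mul_le_mul_of_nonneg_left (hΦF i x hx) (ρ.nonneg i x)
    · rw [image_eq_zero_of_notMem_tsupport hx, zero_mul, zero_mul]
  · -- gradient: `|dχ(v)| ≤ (L(1+η₂) + η₁ Dt) |v| ≤ (L + ε) |v|`
    refine gradSq_le_sq_of_forall_abs_mvfderiv_le g hg (by positivity) (fun v ↦ ?_)
    set nv : ℝ := Real.sqrt (g.val x v v) with hnv
    have hnv0 : 0 ≤ nv := Real.sqrt_nonneg _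
    -- differential of the sum
    have hsumd := (mvfderiv_finset_sum (I := I) Finset.univ (fun i _ ↦ htermd i x)).2
    have hχd : mvfderiv I (fun x ↦ ∑ i, ρ i x * Ψ i x) x v =
        ∑ i, mvfderiv I (fun x ↦ ρ i x * Ψ i x) x v := by
      rw [hsumd]
      simp only [FunLike.coe_sum, Finset.sum_apply]
    -- per-term product rule (or vanishing off the support)
    set A : t → ℝ := fun i ↦ if x ∈ tsupport (ρ i) then mvfderiv I (Ψ i) x v else 0 with hA
    have hT : ∀ i, mvfderiv I (fun x ↦ ρ i x * Ψ i x) x v =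
        ρ i x * A i + Ψ i x * mvfderiv I (ρ i) x v := by
      intro i
      by_cases hx : x ∈ tsupport (ρ i)
      · simp only [hA, if_pos hx]
        have hΨd : MDifferentiableAt I 𝓘(ℝ, ℝ) (Ψ i) x := (hΨs i x hx).mdifferentiableAt (by simp)
        have h := mvfderiv_mul (hρd i x) hΨd
        rw [show (fun x ↦ ρ i x * Ψ i x) = (⇑(ρ i) * Ψ i) from rfl, h]
        simp only [add_apply, FunLike.coe_smul, Pi.smul_apply, smul_eq_mul]
      · simp only [hA, if_neg hx, mul_zero, zero_add]
        have h1 : mvfderiv I (fun x ↦ ρ i x * Ψ i x) x = 0 :=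
          mvfderiv_eq_zero_of_notMem_tsupport (fun h ↦ hx (tsupport_mul_subset_left h))
        have h2 : mvfderiv I (ρ i) x = 0 := mvfderiv_eq_zero_of_notMem_tsupport hx
        simp [h1, h2]
    have hAle : ∀ i, |A i| ≤ L * (1 + η₂) * nv := by
      intro i
      by_cases hx : x ∈ tsupport (ρ i)
      · simp only [hA, if_pos hx]; exact hΦD i x hx v
      · simp only [hA, if_neg hx, abs_zero]; positivity
    -- `∑ dρᵢ = 0`
    have hρsum0 : ∑ i, mvfderiv I (ρ i) x v = 0 := by
      have h := (mvfderiv_finset_sum (I := I) Finset.univ (fun i _ ↦ hρd i x)).2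
      have hconst : (fun x ↦ ∑ i ∈ Finset.univ, ρ i x) = fun _ ↦ (1 : ℝ) := funext hsum
      rw [hconst, mvfderiv_const] at h
      have := congr($h v)
      simpa [FunLike.coe_sum, Finset.sum_apply] using this.symm
    have hBle : ∀ i, |(Ψ i x - F x) * mvfderiv I (ρ i) x v| ≤ η₁ * (D i * nv) := by
      intro i
      by_cases hx : x ∈ tsupport (ρ i)
      · rw [abs_mul]
        exact mul_le_mul (hΦF i x hx) (hD i x v) (abs_nonneg _) hη₁pos.le
      · rw [mvfderiv_eq_zero_of_notMem_tsupport hx]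
        simp only [zero_apply, mul_zero, abs_zero]
        exact mul_nonneg hη₁pos.le (mul_nonneg (hD0 i) hnv0)
    -- assemble
    have hsplit : ∑ i, mvfderiv I (fun x ↦ ρ i x * Ψ i x) x v =
        ∑ i, ρ i x * A i + ∑ i, (Ψ i x - F x) * mvfderiv I (ρ i) x v := by
      simp only [hT, Finset.sum_add_distrib, sub_mul, Finset.sum_sub_distrib, ← Finset.mul_sum,
        hρsum0, mul_zero, sub_zero]
    rw [hχd, hsplit]
    calc |∑ i, ρ i x * A i + ∑ i, (Ψ i x - F x) * mvfderiv I (ρ i) x v|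
        ≤ |∑ i, ρ i x * A i| + |∑ i, (Ψ i x - F x) * mvfderiv I (ρ i) x v| := abs_add_le _ _
      _ ≤ ∑ i, |ρ i x * A i| + ∑ i, |(Ψ i x - F x) * mvfderiv I (ρ i) x v| :=
          add_le_add (Finset.abs_sum_le_sum_abs _ _) (Finset.abs_sum_le_sum_abs _ _)
      _ ≤ ∑ i, ρ i x * (L * (1 + η₂) * nv) + ∑ i, η₁ * (D i * nv) := by
          gcongr with i _ i _
          · rw [abs_mul, abs_of_nonneg (ρ.nonneg i x)]
            exact mul_le_mul_of_nonneg_left (hAle i) (ρ.nonneg i x)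
          · exact hBle i
      _ = (L * (1 + η₂) + η₁ * Dt) * nv := by
          rw [← Finset.sum_mul, hsum x, one_mul, ← Finset.mul_sum, ← Finset.sum_mul]
          ring
      _ ≤ (L + ε) * nv := by
          apply mul_le_mul_of_nonneg_right _ hnv0
          nlinarith

end Global

end Literature.Geometry.Riemannian

end
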